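import Literature.MathematicalPhysics.QuantumLattice.SectorSymbolMasterSmooth
import Literature.Analysis.Fourier.FourierDecayFromDerivBounds
import HarnessLib

/-!
# Decay of the single-scale anisotropic sector propagators (BGM 2006, Lemma 2.2 (2.52))

Topic `Literature/MathematicalPhysics/QuantumLattice`; the endpoint of the chain
`SectorPropagatorSupBound` (order zero) → `SectorPropagatorFourier` (chart and decay transfer) →
`SectorChartPoint` / `SectorSymbolMaster` / `SectorSymbolMasterSmooth` (`h`-uniform `C^m` bounds of
the rescaled symbols by compactness) → `Analysis/Fourier/FourierDecayFromDerivBounds`. PROVED: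

* **`sectorPropagator_decay`** — Lemma 2.2 of Benfatto–Giuliani–Mastropietro (2006), bound (2.52)
  with `r = 1/2`: for `-4 < μ < -2 - √2`, `0 < e₀ ≤ (4+μ)/2` and every `N` there is `C_N` such that
  for ALL scales `h = -n ≤ 0`, all sectors `0 ≤ ω < 2^{n+1} = γ^{-h/2}·2` and all `x = (x₀, x⃗)`,

  `|g^{(h)}_ω(x)| ≤ C_N γ^{(3/2)h} / (1 + |(γ^h x₀, γ^h x'₁, γ^{h/2} x'₂)|/(2π))^N`

  (`γ = 4`, `γ^{(3/2)h} = 4^{-n} 2^{-n}`; `(x'₁, x'₂)` the components of `x⃗` in the frame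
  `(n⃗(θ_{h,ω}), τ⃗(θ_{h,ω}))`; the rescaled point is `sectorChartAdj μ θ n (dualPoint x₀ x)`, whose norm
  is `‖(4^{-n}x₀, 4^{-n}x'₁, 2^{-n}x'₂)‖/(2π)`).

Everything is PROVED; no new definitions.

## Sources

* G. Benfatto, A. Giuliani, V. Mastropietro, *Fermi liquid behavior in the 2D Hubbard model at
  low temperatures*, Ann. Henri Poincaré 7 (2006) 809–898, §2.5 Lemma 2.2 (2.52)
  (arXiv:cond-mat/0507686 p. 11). [BenfattoGiulianiMastropietro2006]
* G. Benfatto, A. Giuliani, V. Mastropietro, Ann. Henri Poincaré 4 (2003) 137–193, Lemma 3.1 /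
  §7.2 (the proof by integration by parts in the anisotropic chart). [BenfattoGiulianiMastropietro2003]
-/

noncomputable section

open Real Set Complex Function Metric MeasureTheory
open scoped Topology FourierTransform
open Literature.Analysis.Fourier

namespace Literature.MathematicalPhysics.QuantumLattice

variable {μ : ℝ} (hμ₁ : -4 < μ) (hμ₂ : μ < -2 - Real.sqrt 2)
include hμ₁ hμ₂

/-- The rescaled sector symbol is smooth. [folklore] -/
theorem contDiff_rescaledSectorSymbol {e₀ : ℝ} (he : 0 < e₀) (he' : e₀ ≤ (4 + μ) / 2) (n : ℕ) (ω : ℤ) :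
    ContDiff ℝ ((⊤ : ℕ∞) : WithTop ℕ∞) (rescaledSectorSymbol hμ₁ hμ₂ e₀ n ω) := by
  rw [rescaledSectorSymbol_eq_smul_masterLift hμ₁ hμ₂ he he' n ω]
  exact (((contDiff_masterLift hμ₁ hμ₂ he).comp (contDiff_const.prodMk contDiff_id))).const_smul (((4 : ℝ) ^ n : ℝ) : ℂ)

/-- The rescaled sector symbol is supported in the (compact) box. [folklore] -/
theorem tsupport_rescaledSectorSymbol_subset {e₀ : ℝ} (he : 0 < e₀) (he' : e₀ ≤ (4 + μ) / 2) (n : ℕ) (ω : ℤ) :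
    tsupport (rescaledSectorSymbol hμ₁ hμ₂ e₀ n ω) ⊆
      {t : MomSpace | |t 0| ≤ e₀ ∧ |t 1| ≤ normalExtentConst μ e₀ ∧ |t 2| ≤ tangentExtentConst μ e₀} :=
  closure_minimal (fun _ hu => abs_le_of_rescaledSectorSymbol_ne_zero hμ₁ hμ₂ he he' hu) (isCompact_momBox _ _ _).isClosed

/-- **Lemma 2.2 of Benfatto–Giuliani–Mastropietro (2006), bound (2.52)** (`γ = 4`, `h = -n`): for
`0 < e₀ ≤ (4+μ)/2` and every `N` there is `C` with

`‖g^{(h)}_ω(x₀, x⃗)‖ ≤ C · 4^{-n} 2^{-n} · (1 + ‖(4^{-n}x₀, 4^{-n}x'₁, 2^{-n}x'₂)‖/(2π))^{-N}`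

for all `n`, all sectors `0 ≤ ω < 2^{n+1}` and all `(x₀, x⃗)`. [cite: BenfattoGiulianiMastropietro2006, §2.5 Lemma 2.2 (2.52)] -/
theorem sectorPropagator_decay {e₀ : ℝ} (he : 0 < e₀) (he' : e₀ ≤ (4 + μ) / 2) (N : ℕ) :
    ∃ C : ℝ, 0 ≤ C ∧ ∀ (n : ℕ) (ω : ℕ), ω < sectorCount n → ∀ (x₀ : ℝ) (x : Fin 2 → ℝ),
      ‖sectorPropagator e₀ μ n ω x₀ x‖ ≤
        C * ((4 : ℝ) ^ (-(n : ℤ)) * (2 : ℝ) ^ (-(n : ℤ))) *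
          ((1 + ‖sectorChartAdj μ (((ω : ℝ) + 1 / 2) * sectorWidth n) n (dualPoint x₀ x)‖) ^ N)⁻¹ := by
  -- `h`-uniform derivative bounds up to order `N`
  choose B hB0 hB using fun m => exists_norm_iteratedFDeriv_rescaledSectorSymbol_le hμ₁ hμ₂ he he' m
  set Bs : ℝ := ∑ m ∈ Finset.range (N + 1), B m with hBs
  have hBs0 : 0 ≤ Bs := Finset.sum_nonneg fun m _ => hB0 m
  have hBle : ∀ m ≤ N, B m ≤ Bs := fun m hm =>
    Finset.single_le_sum (fun k _ => hB0 k) (Finset.mem_range.2 (Nat.lt_succ_of_le hm))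
  -- the box and its volume
  set T : Set MomSpace := {t | |t 0| ≤ e₀ ∧ |t 1| ≤ normalExtentConst μ e₀ ∧ |t 2| ≤ tangentExtentConst μ e₀} with hT
  have hTc : IsCompact T := isCompact_momBox _ _ _
  have hTfin : volume T < ⊤ := hTc.measure_lt_top
  set vol : ℝ := (volume T).toReal with hvol
  refine ⟨2 ^ N * (Bs * vol), by positivity, fun n ω hω x₀ x => ?_⟩
  -- the rescaled symbol of this sector
  set f := rescaledSectorSymbol hμ₁ hμ₂ e₀ n (ω : ℤ) with hf
  have hfc : ContDiff ℝ ((⊤ : ℕ∞) : WithTop ℕ∞) f := contDiff_rescaledSectorSymbol hμ₁ hμ₂ he he' n ω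
  have hsub : tsupport f ⊆ T := tsupport_rescaledSectorSymbol_subset hμ₁ hμ₂ he he' n ω
  have hsupp : HasCompactSupport f := hTc.of_isClosed_subset (isClosed_tsupport _) hsub
  have hM : ∀ m ≤ N, ∀ t, ‖iteratedFDeriv ℝ m f t‖ ≤ (4 : ℝ) ^ n * Bs := fun m hm t =>
    (hB m n ω hω t).trans (mul_le_mul_of_nonneg_left (hBle m hm) (by positivity))
  have hvolle : (volume (tsupport f)).toReal ≤ vol :=
    ENNReal.toReal_mono hTfin.ne (measure_mono hsub)
  -- Fourier decay of the rescaled symbol, then the decay transfer through the chart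
  have hK : ∀ y, ‖𝓕 f y‖ ≤ 2 ^ N * ((4 : ℝ) ^ n * Bs * vol) * ((1 + ‖y‖) ^ N)⁻¹ := fun y =>
    norm_fourier_le_of_iteratedFDeriv_le hfc hsupp hM hvolle y
  have h := norm_sectorPropagator_le_of_fourier_decay hμ₁ hμ₂ hK x₀ x
  push_cast at h ⊢
  refine h.trans (le_of_eq ?_)
  have h44 : (4 : ℝ) ^ (-(n : ℤ)) * (4 : ℝ) ^ n = 1 := by
    rw [zpow_neg, zpow_natCast, inv_mul_cancel₀ (by positivity)]
  linear_combination (2 ^ N * Bs * vol * (4 : ℝ) ^ (-(n : ℤ)) * (2 : ℝ) ^ (-(n : ℤ)) *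
    ((1 + ‖sectorChartAdj μ (((ω : ℝ) + 1 / 2) * sectorWidth n) n (dualPoint x₀ x)‖) ^ N)⁻¹) * h44

end Literature.MathematicalPhysics.QuantumLattice

end
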